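import Mathlib
import HarnessLib
import Summits.Ventures.LatticeQCDFlow.Scoring.DoeblinWindowBracket
import Summits.Ventures.LatticeQCDFlow.Scoring.IndepMHKernelPositive
import Summits.Ventures.LatticeQCDFlow.Scoring.FlowSamplerAutocorrelation

/-!
# The two-sided window bracket of the exact flow sampler:
# `τ_W(2m) ≤ τ_int ≤ τ_W(2m) + (e^{2δ} − 1)·ρ(2m)` for every bounded observable — unconditional

HONEST FRAMING: exact (Metropolis-corrected) sampling algorithms for lattice gauge theory;
figures of merit are autocorrelation/cost numbers at stated couplings and volumes; no
continuum-physics claim.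

Venture `LatticeQCDFlow` (cell pub-lqcd), topic `Scoring`; FANOUT row 8 (`s0-cpn-nemc`, GEN-11).
NEW WORK of the cell (two compositions), not a published result: the lower side from the positivity
of the flow-MCMC kernel (`Scoring/IndepMHKernelPositive.lean`: `indepMH_tauIntWindow_le_tauInt`, row
2's positivity of `imhOp` through the dictionary) and the upper side from reversibility + Doeblin
(`Scoring/DoeblinWindowBracket.lean`: `tauInt_le_window_even_of_doeblin` / `_odd_`; row 30's
`Exactness.indepMH_isReversible`), instantiated on the tree's exact flow-MCMC theorem
`Exactness.flowSampler_exact_doeblin` (`Exactness/ApproxTrivializingSampler.lean`, UNCONDITIONAL).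
This is the general-state-space form of row 8's finite-pool `Scoring/IMHWindowBracket.lean`.
Nothing is cited as a fact.

## What is proved

* §1 (any measurable space; `q` a probability law, `w > 0` measurable `q`-integrable,
  `π = w·q` a probability law with `K(x,·) ≥ ε π`, `ε > 0`, `K = indepMH q w`; `f` bounded measurable
  `π`-centred, `ρ(t) = autocov K π f t / autocov K π f 0`) **`indepMH_window_bracket_even`**:
  `τ_W(2m) ≤ τ_int ≤ τ_W(2m) + (1/ε − 1)·ρ(2m)` for every `m`; **`indepMH_window_bracket_odd`**:
  `τ_W(2m+1) ≤ τ_int ≤ τ_W(2m+1) + (1/ε − 1)(1 − ε)·ρ(2m)`.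
* §2 (lattice `SU(n)^E`, UNCONDITIONAL) **`flowSampler_window_bracket`**: smooth action `S`, jointly
  smooth flow action with uniform defect `δ` of Lüscher's equation (4.5), `𝓕` integrating `−∂S̃_t`,
  `q = (𝓕_1)_* D[V]`: with the weight `w` of `flowSampler_exact_doeblin` (`w·q = π := 𝒵⁻¹e^{−S}D[U]`,
  `indepMH q w` exact), EVERY bounded measurable `π`-centred observable satisfies, for every `m`,
  `τ_W(2m) ≤ τ_int ≤ τ_W(2m) + (e^{2δ} − 1)·ρ(2m)` and
  `τ_W(2m+1) ≤ τ_int ≤ τ_W(2m+1) + (e^{2δ} − 1)(1 − e^{−2δ})·ρ(2m)`.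

Reading (markdown): for the exact flow sampler the figure of merit `τ_int` of every bounded observable
is bracketed by two FINITE-WINDOW expressions of the true autocorrelation function whose gap
`(e^{2δ} − 1)·ρ(2m)` is itself read off the window; the Γ-method's truncation is certified from both
sides at kernel level, at every volume at which the defect bound holds.  NOT CLAIMED: estimator noise,
the automatic-window rule, any number of ours, and how `δ` scales with volume (theory-1's subject).
-/

noncomputable section

namespace Summit.Ventures.LatticeQCDFlow.Scoring

open MeasureTheory ProbabilityTheory Filter Finset Summit.Ventures.LatticeQCDFlow.Exactness
open scoped ENNReal Topology

variable {Ω : Type*} [MeasurableSpace Ω]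

/-! ### §1 The flow-MCMC kernel with a Doeblin constant -/

section Kernel

variable {q : Measure Ω} [IsProbabilityMeasure q] {w : Ω → ℝ} {π : Measure Ω}
  [IsProbabilityMeasure π] {ε : ℝ≥0∞}

/-- **Two-sided window bracket, even form**: `τ_W(2m) ≤ τ_int ≤ τ_W(2m) + (1/ε − 1)·ρ(2m)`. -/
theorem indepMH_window_bracket_even (hw : Measurable w) (hw0 : ∀ x, 0 < w x)
    (hwi : Integrable w q) (hπ : (q.withDensity fun x => ENNReal.ofReal (w x)) = π)
    (hmin : ∀ x {B : Set Ω}, MeasurableSet B → ε * π B ≤ indepMH q w x B) (hε0 : 0 < ε)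
    {f : Ω → ℝ} (hf : Measurable f) {C : ℝ} (hC : ∀ x, |f x| ≤ C) (hf0 : ∫ x, f x ∂π = 0)
    (m : ℕ) :
    tauIntWindow (fun t => autocov (indepMH q w) π f t / autocov (indepMH q w) π f 0) (2 * m)
        ≤ tauInt (fun t => autocov (indepMH q w) π f t / autocov (indepMH q w) π f 0) ∧
      tauInt (fun t => autocov (indepMH q w) π f t / autocov (indepMH q w) π f 0)
        ≤ tauIntWindow (fun t => autocov (indepMH q w) π f t / autocov (indepMH q w) π f 0) (2 * m)
          + (1 / ε.toReal - 1) * (autocov (indepMH q w) π f (2 * m) / autocov (indepMH q w) π f 0) := by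
  haveI : Fact (Measurable w) := ⟨hw⟩
  have hrev : Kernel.IsReversible (indepMH q w) π := by
    rw [← hπ]; exact indepMH_isReversible hw hw0
  have hs := summable_acf_of_doeblin hrev.invariant hmin hε0 hf hC hf0
  exact ⟨indepMH_tauIntWindow_le_tauInt hw hw0 hwi hπ hf hC hs (2 * m),
    tauInt_le_window_even_of_doeblin hrev hmin hε0 hf hC hf0 m⟩

/-- **Two-sided window bracket, odd form**:
`τ_W(2m+1) ≤ τ_int ≤ τ_W(2m+1) + (1/ε − 1)(1 − ε)·ρ(2m)`. -/
theorem indepMH_window_bracket_odd (hw : Measurable w) (hw0 : ∀ x, 0 < w x)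
    (hwi : Integrable w q) (hπ : (q.withDensity fun x => ENNReal.ofReal (w x)) = π)
    (hmin : ∀ x {B : Set Ω}, MeasurableSet B → ε * π B ≤ indepMH q w x B) (hε0 : 0 < ε)
    {f : Ω → ℝ} (hf : Measurable f) {C : ℝ} (hC : ∀ x, |f x| ≤ C) (hf0 : ∫ x, f x ∂π = 0)
    (m : ℕ) :
    tauIntWindow (fun t => autocov (indepMH q w) π f t / autocov (indepMH q w) π f 0) (2 * m + 1)
        ≤ tauInt (fun t => autocov (indepMH q w) π f t / autocov (indepMH q w) π f 0) ∧
      tauInt (fun t => autocov (indepMH q w) π f t / autocov (indepMH q w) π f 0)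
        ≤ tauIntWindow (fun t => autocov (indepMH q w) π f t / autocov (indepMH q w) π f 0)
            (2 * m + 1)
          + (1 / ε.toReal - 1) * (1 - ε.toReal)
            * (autocov (indepMH q w) π f (2 * m) / autocov (indepMH q w) π f 0) := by
  haveI : Fact (Measurable w) := ⟨hw⟩
  have hrev : Kernel.IsReversible (indepMH q w) π := by
    rw [← hπ]; exact indepMH_isReversible hw hw0
  have hs := summable_acf_of_doeblin hrev.invariant hmin hε0 hf hC hf0
  exact ⟨indepMH_tauIntWindow_le_tauInt hw hw0 hwi hπ hf hC hs (2 * m + 1),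
    tauInt_le_window_odd_of_doeblin hrev hmin hε0 hf hC hf0 m⟩

end Kernel

/-! ### §2 The lattice: the exact flow sampler on `SU(n)^E` — UNCONDITIONAL -/

section Lattice

open Literature.MathematicalPhysics.QuantumFieldTheory
open Literature.MathematicalPhysics.QuantumFieldTheory.Luscher2010
open Summit.Ventures.LatticeQCDFlow.TrivializingMaps
open scoped Matrix Matrix.Norms.Frobenius ContDiff

variable {d L n : ℕ} [NeZero L]

/-- **The two-sided window bracket of the exact flow sampler — UNCONDITIONAL.**  Under the
hypotheses of `Scoring.flowSampler_autocorrelation` (smooth `S`, jointly smooth flow action with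
uniform defect `δ` of Lüscher's equation (4.5), `𝓕` integrating `−∂S̃_t`, `q = (𝓕_1)_* D[V]`): with
the weight `w` of `flowSampler_exact_doeblin` (`w·q = π := 𝒵⁻¹e^{−S}D[U]`, `indepMH q w` EXACT),
every bounded measurable `π`-centred observable `f` has, for every `m`,
`τ_W(2m) ≤ τ_int(f) ≤ τ_W(2m) + (e^{2δ} − 1)·ρ(2m)` and
`τ_W(2m+1) ≤ τ_int(f) ≤ τ_W(2m+1) + (e^{2δ} − 1)(1 − e^{−2δ})·ρ(2m)`. -/
theorem flowSampler_window_bracket (B : SuBasis n)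
    {S : AmbConfig d L n → ℝ} (hS : ContDiff ℝ ∞ S) {F : ℝ → AmbConfig d L n → ℝ}
    (hF : ContDiff ℝ ∞ fun p : ℝ × AmbConfig d L n => F p.1 p.2)
    {Φ : ℝ → GaugeConfig d L (Matrix.specialUnitaryGroup (Fin n) ℂ) →
      GaugeConfig d L (Matrix.specialUnitaryGroup (Fin n) ℂ)}
    (hΦ : IsFlowMap (fun t W => -linkGrad B (F t) W) Φ) {c : ℝ → ℝ} {δ : ℝ}
    (hδ : ∀ t ∈ Set.Icc (0 : ℝ) 1, ∀ U : GaugeConfig d L (Matrix.specialUnitaryGroup (Fin n) ℂ),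
      |luscherL B S t (F t) (WilsonFlow.coeConfig U) - S (WilsonFlow.coeConfig U) - c t| ≤ δ)
    (q : Measure (GaugeConfig d L (Matrix.specialUnitaryGroup (Fin n) ℂ))) [IsProbabilityMeasure q]
    (hq : q = Measure.map (Φ 1) (trivialMeasure (Matrix.specialUnitaryGroup (Fin n) ℂ) d L)) :
    ∃ w : GaugeConfig d L (Matrix.specialUnitaryGroup (Fin n) ℂ) → ℝ, Measurable w ∧
      (q.withDensity fun U => ENNReal.ofReal (w U)) =
        boltzmannMeasure (fun U : GaugeConfig d L (Matrix.specialUnitaryGroup (Fin n) ℂ) =>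
          S (WilsonFlow.coeConfig U)) ∧
      Kernel.Invariant (indepMH q w)
        (boltzmannMeasure fun U : GaugeConfig d L (Matrix.specialUnitaryGroup (Fin n) ℂ) =>
          S (WilsonFlow.coeConfig U)) ∧
      ∀ (f : GaugeConfig d L (Matrix.specialUnitaryGroup (Fin n) ℂ) → ℝ), Measurable f →
        ∀ C : ℝ, (∀ U, |f U| ≤ C) →
        ∫ U, f U ∂(boltzmannMeasure fun U : GaugeConfig d L (Matrix.specialUnitaryGroup (Fin n) ℂ) =>
            S (WilsonFlow.coeConfig U)) = 0 →
        ∀ m : ℕ,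
          (tauIntWindow (fun t =>
                autocov (indepMH q w)
                    (boltzmannMeasure fun U : GaugeConfig d L (Matrix.specialUnitaryGroup (Fin n) ℂ) =>
                      S (WilsonFlow.coeConfig U)) f t /
                  autocov (indepMH q w)
                    (boltzmannMeasure fun U : GaugeConfig d L (Matrix.specialUnitaryGroup (Fin n) ℂ) =>
                      S (WilsonFlow.coeConfig U)) f 0) (2 * m)
              ≤ tauInt (fun t =>
                autocov (indepMH q w)
                    (boltzmannMeasure fun U : GaugeConfig d L (Matrix.specialUnitaryGroup (Fin n) ℂ) =>
                      S (WilsonFlow.coeConfig U)) f t /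
                  autocov (indepMH q w)
                    (boltzmannMeasure fun U : GaugeConfig d L (Matrix.specialUnitaryGroup (Fin n) ℂ) =>
                      S (WilsonFlow.coeConfig U)) f 0) ∧
            tauInt (fun t =>
                autocov (indepMH q w)
                    (boltzmannMeasure fun U : GaugeConfig d L (Matrix.specialUnitaryGroup (Fin n) ℂ) =>
                      S (WilsonFlow.coeConfig U)) f t /
                  autocov (indepMH q w)
                    (boltzmannMeasure fun U : GaugeConfig d L (Matrix.specialUnitaryGroup (Fin n) ℂ) =>
                      S (WilsonFlow.coeConfig U)) f 0)
              ≤ tauIntWindow (fun t =>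
                autocov (indepMH q w)
                    (boltzmannMeasure fun U : GaugeConfig d L (Matrix.specialUnitaryGroup (Fin n) ℂ) =>
                      S (WilsonFlow.coeConfig U)) f t /
                  autocov (indepMH q w)
                    (boltzmannMeasure fun U : GaugeConfig d L (Matrix.specialUnitaryGroup (Fin n) ℂ) =>
                      S (WilsonFlow.coeConfig U)) f 0) (2 * m)
                + (Real.exp (2 * δ) - 1) *
                  (autocov (indepMH q w)
                      (boltzmannMeasure fun U : GaugeConfig d L (Matrix.specialUnitaryGroup (Fin n) ℂ) =>
                        S (WilsonFlow.coeConfig U)) f (2 * m) /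
                    autocov (indepMH q w)
                      (boltzmannMeasure fun U : GaugeConfig d L (Matrix.specialUnitaryGroup (Fin n) ℂ) =>
                        S (WilsonFlow.coeConfig U)) f 0)) ∧
          (tauIntWindow (fun t =>
                autocov (indepMH q w)
                    (boltzmannMeasure fun U : GaugeConfig d L (Matrix.specialUnitaryGroup (Fin n) ℂ) =>
                      S (WilsonFlow.coeConfig U)) f t /
                  autocov (indepMH q w)
                    (boltzmannMeasure fun U : GaugeConfig d L (Matrix.specialUnitaryGroup (Fin n) ℂ) =>
                      S (WilsonFlow.coeConfig U)) f 0) (2 * m + 1)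
              ≤ tauInt (fun t =>
                autocov (indepMH q w)
                    (boltzmannMeasure fun U : GaugeConfig d L (Matrix.specialUnitaryGroup (Fin n) ℂ) =>
                      S (WilsonFlow.coeConfig U)) f t /
                  autocov (indepMH q w)
                    (boltzmannMeasure fun U : GaugeConfig d L (Matrix.specialUnitaryGroup (Fin n) ℂ) =>
                      S (WilsonFlow.coeConfig U)) f 0) ∧
            tauInt (fun t =>
                autocov (indepMH q w)
                    (boltzmannMeasure fun U : GaugeConfig d L (Matrix.specialUnitaryGroup (Fin n) ℂ) =>
                      S (WilsonFlow.coeConfig U)) f t /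
                  autocov (indepMH q w)
                    (boltzmannMeasure fun U : GaugeConfig d L (Matrix.specialUnitaryGroup (Fin n) ℂ) =>
                      S (WilsonFlow.coeConfig U)) f 0)
              ≤ tauIntWindow (fun t =>
                autocov (indepMH q w)
                    (boltzmannMeasure fun U : GaugeConfig d L (Matrix.specialUnitaryGroup (Fin n) ℂ) =>
                      S (WilsonFlow.coeConfig U)) f t /
                  autocov (indepMH q w)
                    (boltzmannMeasure fun U : GaugeConfig d L (Matrix.specialUnitaryGroup (Fin n) ℂ) =>
                      S (WilsonFlow.coeConfig U)) f 0) (2 * m + 1)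
                + (Real.exp (2 * δ) - 1) * (1 - Real.exp (-(2 * δ))) *
                  (autocov (indepMH q w)
                      (boltzmannMeasure fun U : GaugeConfig d L (Matrix.specialUnitaryGroup (Fin n) ℂ) =>
                        S (WilsonFlow.coeConfig U)) f (2 * m) /
                    autocov (indepMH q w)
                      (boltzmannMeasure fun U : GaugeConfig d L (Matrix.specialUnitaryGroup (Fin n) ℂ) =>
                        S (WilsonFlow.coeConfig U)) f 0)) := by
  obtain ⟨w, hw, hlo, hhi, hπ, hinv, -, hdoeb⟩ := flowSampler_exact_doeblin B hS hF hΦ hδ q hq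
  haveI : Fact (Measurable w) := ⟨hw⟩
  have hS'c : Continuous fun U : GaugeConfig d L (Matrix.specialUnitaryGroup (Fin n) ℂ) =>
      S (WilsonFlow.coeConfig U) := hS.continuous.comp WilsonFlow.continuous_coeConfig
  haveI := isProbabilityMeasure_boltzmannMeasure (d := d) (L := L) hS'c
  have hε0 : 0 < ENNReal.ofReal (Real.exp (-(2 * δ))) := ENNReal.ofReal_pos.2 (Real.exp_pos _)
  have hw0 : ∀ U, 0 < w U := fun U => (Real.exp_pos _).trans_le (hlo U)
  have hwi : Integrable w q :=
    integrable_of_bounded q hw (C := Real.exp (2 * δ)) fun U => by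
      rw [abs_of_pos (hw0 U)]; exact hhi U
  have hεr : (ENNReal.ofReal (Real.exp (-(2 * δ)))).toReal = Real.exp (-(2 * δ)) :=
    ENNReal.toReal_ofReal (Real.exp_pos _).le
  have hconst : 1 / (ENNReal.ofReal (Real.exp (-(2 * δ)))).toReal - 1 = Real.exp (2 * δ) - 1 := by
    rw [hεr, Real.exp_neg, one_div, inv_inv]
  refine ⟨w, hw, hπ, hinv, fun f hf C hC hf0 m => ⟨?_, ?_⟩⟩
  · have h := indepMH_window_bracket_even hw hw0 hwi hπ (fun x B hB => hdoeb x hB) hε0 hf hC hf0 m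
    rwa [hconst] at h
  · have h := indepMH_window_bracket_odd hw hw0 hwi hπ (fun x B hB => hdoeb x hB) hε0 hf hC hf0 m
    rwa [hconst, hεr] at h

end Lattice

end Summit.Ventures.LatticeQCDFlow.Scoring

end
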